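import Mathlib
import Summits.NavierStokesRegularity.NavierStokesRegularity.Theorems.EulerZoomLiouvillePowerGaugeEulerLiouvilleClockTransferTranslate
import Summits.NavierStokesRegularity.NavierStokesRegularity.Theorems.EulerZoomLiouvillePowerGaugeEulerLiouvilleClockTransferWeights
import Summits.NavierStokesRegularity.NavierStokesRegularity.Theorems.EulerZoomLiouvillePowerGaugeEulerLiouvilleSelfSimilarWeakToClassical
import Summits.NavierStokesRegularity.NavierStokesRegularity.Theorems.EulerZoomLiouvillePowerGaugeEulerLiouvilleSelfSimilarBernoulliSqueezeSharp
import Summits.NavierStokesRegularity.NavierStokesRegularity.Theorems.EulerZoomLiouvillePowerGaugeEulerLiouvilleSelfSimilarShiftedBoundedC2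
import Summits.NavierStokesRegularity.NavierStokesRegularity.Theorems.EulerZoomLiouvillePowerGaugeEulerLiouvilleSelfSimilarPastProfileGradient
import Literature.Analysis.FluidPDE.SuitableWeakCongr
import Literature.Analysis.FluidPDE.PeriodicLerayGradient
import HarnessLib

/-!
# CENTRE/EXPONENT TRANSFER of past power clocks: a `T₁ = T ≤ 0` clock of rate `1/(2+ρ)` with `C²` profile in a class-`ρ₀` member IS an
# exactly self-similar class-`ρ` member about the ORIGIN — «the window is THE ONE STATEMENT at ρ′»
# (crux `EulerZoomLiouville.PowerGaugeEulerLiouville` = stmt-NavierStokesRegularity-19832; line `logtime-breathers`, residue T4 «window clocks»)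

Route `EulerZoomLiouville` (NavierStokesRegularity); width seat ns-ezl-w6 g2 (cell ns-regularity-ideate, LEAD ns-typeII-p2 g12).  THE THEOREM
(`ClockTransfer.exists_inClass_selfSimilarCollapse`): let `(u, p, H)` be a member of Seregin's class with exponent `ρ₀` (crux hypotheses verbatim; `ρ₀` is
only used through ONE origin cylinder), and suppose that for ALL `τ < T`, where `T ≤ 0` (collapse INSIDE the slab or AT its final time — the `T₁ = T` case of
the skeleton's velocity-only `IsPastSelfSimilar ρ T T x₀ u W` / of the past clause of `IsOffRateSelfSimilar`),
`u(τ, x) = (T−τ)^{γ−1} W((T−τ)^{−γ}(x − x₀))`, `p(τ, x) = (T−τ)^{2γ−2} Q((T−τ)^{−γ}(x − x₀))` with `γ = 1/(2+ρ)`, `−1/2 < ρ < 1`, and `W ∈ C²`.  Then the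
ORIGIN-CENTRED ANSATZ `(selfSimilarCollapse γ 0 W, selfSimilarCollapsePressure γ 0 Q)` — which is EXACTLY SELF-SIMILAR ABOUT THE ORIGIN AT THE CLASS RATE OF `ρ`
(`IsExactlySelfSimilar ρ · · W Q` by `rfl`) — is, with the self-similar gradient `H″(τ) = (−τ)^{−1} • ∇W((−τ)^{−γ} ·)`, a member of Seregin's class WITH EXPONENT
`ρ`: suitable weak Euler pair on the slab (translation `…ClockTransferTranslate` + a.e. congruence), weak gradient (identification `exists_profileGradient_ae` +
uniqueness of weak derivatives), and the three gauges `a^{2ρ}A + a^{ρ}E + a^{2ρ}D ≤ c′` for ALL `a > 0` (own-rate weights finite by `…ClockTransferWeights` — large scales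
from the ONE origin cylinder `Q_{R₀}(0,0) ⊇ Q_1(T,x₀)`, small scales from `W ∈ C²` and, for the pressure, the bridge `WeakToClassical.pressureProfile_ae_eq_add_const`
`Q = P′ + c₀` a.e. with `P′ ∈ C¹` — and the reverse dictionary `…ClockTransferGauges`).  COROLLARIES: `ae_eq_zero_of_selfSimilarCollapse_ae_eq_zero` (the ansatz
member trivial ⇒ `W = 0` ⇒ the original member trivial, `ρ₀ ≥ 0`) and the BY-NAME INTERFACE `ae_eq_zero_of_originAnalysis`: if every class-`ρ` member exactly
self-similar about the origin with profile `(W, Q)` is trivial, so is the clock member.  READING FOR THE SKELETON: with `ρ = ρ′ := 1/g − 2`, the surviving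
window clocks `g ∈ [2/5, 1/(2+ρ₀))` with `T₁ = T` and `C²` profile (ρ′ ∈ (ρ₀, ½]) and the past-exact CLASS-RATE `T₁ = T` clocks (ρ′ = ρ₀) are LITERALLY instances of
the origin-centred analysis at `ρ′`: every filled `ρ′`-stratum and `stub_selfSimilarC2Needle ρ′` apply to the ansatz member inside `PowerGaugeEulerLiouville_of`
(whose stubs quantify over all exponents) — no new residue.  `T₁ < T` (the representation stops before the collapse) does NOT transfer.
WHAT THIS IS NOT: not NS, not E — a REDUCTION between strata of the crux CLASS 19832 on the MODEL lattice (`--supports` stmt-19832); it kills nothing by itself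
(THE ONE STATEMENT stays open at every exponent); 19832 OPEN; NS regularity NOT proved. [folklore]
-/

noncomputable section

-- flat `Theorems/<Route><Decl>…` files of one crux share the namespace of the crux (tree convention: `Summit.<S>.<S>.…`)
set_option linter.dupNamespace false

open MeasureTheory Set Filter Topology Metric Function TopologicalSpace
open scoped ENNReal NNReal

namespace Summit.NavierStokesRegularity.NavierStokesRegularity.Theorems.PowerGaugeEulerLiouville

open Literature.Analysis Literature.Analysis.FunctionSpaces Literature.Analysis.FluidPDE

namespace ClockTransfer

variable {ρ₀ ρ T : ℝ} {x₀ : EuclideanSpace ℝ (Fin 3)} {c : ℝ≥0}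
  {u : ℝ → EuclideanSpace ℝ (Fin 3) → EuclideanSpace ℝ (Fin 3)} {p : ℝ → EuclideanSpace ℝ (Fin 3) → ℝ}
  {H : ℝ → EuclideanSpace ℝ (Fin 3) → EuclideanSpace ℝ (Fin 3) →L[ℝ] EuclideanSpace ℝ (Fin 3)}
  {W : EuclideanSpace ℝ (Fin 3) → EuclideanSpace ℝ (Fin 3)} {Q : EuclideanSpace ℝ (Fin 3) → ℝ}

/-- From `ofReal r * x ≤ c` with `r > 0`, `c < ∞`: `x ≠ ∞`. [folklore] -/
theorem ne_top_of_ofReal_mul_le {r : ℝ} (hr : 0 < r) {x : ℝ≥0∞} {c : ℝ≥0} (h : ENNReal.ofReal r * x ≤ (c : ℝ≥0∞)) :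
    x ≠ ⊤ := by
  intro hx
  rw [hx, ENNReal.mul_top (by rwa [ENNReal.ofReal_ne_zero_iff])] at h
  exact absurd h (by simp)

/-- **THE CENTRE/EXPONENT TRANSFER.**  See the module docstring: a class-`ρ₀` member whose velocity and pressure are an exact power clock of rate
`1/(2+ρ)` about `(T, x₀)` for all `τ < T` (`T ≤ 0`, `−1/2 < ρ < 1`, `W ∈ C²`) yields the ORIGIN-CENTRED ANSATZ as a class-`ρ` member: suitable weak Euler
pair + weak gradient on `(−∞,0) × ℝ³` and `a^{2ρ}A(a) + a^{ρ}E(a) + a^{2ρ}D(a) ≤ c′` at the origin for every `a > 0`. [folklore] -/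
theorem exists_inClass_selfSimilarCollapse (hρ : -1 / 2 < ρ) (hρ1 : ρ < 1)
    (hsw : IsSuitableWeakSolutionOn (slab (EuclideanSpace ℝ (Fin 3)) (Iio 0) isOpen_Iio) 0 0 u p)
    (hH : HasWeakSpatialGradientOn (slab (EuclideanSpace ℝ (Fin 3)) (Iio 0) isOpen_Iio) u H)
    (hgauge : ∀ a : ℝ, 0 < a →
      ENNReal.ofReal (a ^ (2 * ρ₀)) * cknA a (0 : ℝ × EuclideanSpace ℝ (Fin 3)) u +
          ENNReal.ofReal (a ^ ρ₀) * cknE a (0 : ℝ × EuclideanSpace ℝ (Fin 3)) H +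
        ENNReal.ofReal (a ^ (2 * ρ₀)) * cknD a (0 : ℝ × EuclideanSpace ℝ (Fin 3)) p ≤ (c : ℝ≥0∞))
    (hT : T ≤ 0) (x₀ : EuclideanSpace ℝ (Fin 3))
    (hu : ∀ τ : ℝ, τ < T → u τ = fun x => selfSimilarCollapse (1 / (2 + ρ)) T W τ (x - x₀))
    (hp : ∀ τ : ℝ, τ < T → p τ = fun x => selfSimilarCollapsePressure (1 / (2 + ρ)) T Q τ (x - x₀))
    (hW : ContDiff ℝ 2 W) :
    ∃ (H'' : ℝ → EuclideanSpace ℝ (Fin 3) → EuclideanSpace ℝ (Fin 3) →L[ℝ] EuclideanSpace ℝ (Fin 3)) (c' : ℝ≥0),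
      IsSuitableWeakSolutionOn (slab (EuclideanSpace ℝ (Fin 3)) (Iio 0) isOpen_Iio) 0 0
          (selfSimilarCollapse (1 / (2 + ρ)) 0 W) (selfSimilarCollapsePressure (1 / (2 + ρ)) 0 Q) ∧
        HasWeakSpatialGradientOn (slab (EuclideanSpace ℝ (Fin 3)) (Iio 0) isOpen_Iio)
          (selfSimilarCollapse (1 / (2 + ρ)) 0 W) H'' ∧
        ∀ a : ℝ, 0 < a →
          ENNReal.ofReal (a ^ (2 * ρ)) * cknA a (0 : ℝ × EuclideanSpace ℝ (Fin 3)) (selfSimilarCollapse (1 / (2 + ρ)) 0 W) +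
              ENNReal.ofReal (a ^ ρ) * cknE a (0 : ℝ × EuclideanSpace ℝ (Fin 3)) H'' +
            ENNReal.ofReal (a ^ (2 * ρ)) * cknD a (0 : ℝ × EuclideanSpace ℝ (Fin 3))
              (selfSimilarCollapsePressure (1 / (2 + ρ)) 0 Q) ≤ (c' : ℝ≥0∞) := by
  have hρ2 : 0 < 2 + ρ := by linarith
  set γ : ℝ := 1 / (2 + ρ) with hγ
  have hγρ : γ * (2 + ρ) = 1 := by rw [hγ]; field_simp
  have hγ0 : 0 < γ := by rw [hγ]; positivity
  have hγ1 : γ ≤ 1 := by rw [hγ, div_le_one hρ2]; linarith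
  set ut : ℝ → EuclideanSpace ℝ (Fin 3) → EuclideanSpace ℝ (Fin 3) := selfSimilarCollapse γ 0 W with hut
  set pt : ℝ → EuclideanSpace ℝ (Fin 3) → ℝ := selfSimilarCollapsePressure γ 0 Q with hpt
  -- ### (0) the translate and its a.e. agreement with the ansatz on the slab
  have hsw' := isSuitableWeakSolutionOn_translate hsw hT x₀
  have hH' := hasWeakSpatialGradientOn_translate hH hT x₀
  have hu' : ∀ τ : ℝ, τ < 0 → stPull 1 1 T x₀ u τ = ut τ := translate_velocity_eq hu
  have hp' : ∀ τ : ℝ, τ < 0 → stPull 1 1 T x₀ p τ = pt τ := translate_pressure_eq hp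
  have hSm : MeasurableSet (((slab (EuclideanSpace ℝ (Fin 3)) (Iio 0) isOpen_Iio : Opens (ℝ × EuclideanSpace ℝ (Fin 3))) :
      Set (ℝ × EuclideanSpace ℝ (Fin 3)))) :=
    (slab (EuclideanSpace ℝ (Fin 3)) (Iio 0) isOpen_Iio).2.measurableSet
  have huae : ∀ᵐ z ∂(volume.restrict (((slab (EuclideanSpace ℝ (Fin 3)) (Iio 0) isOpen_Iio :
      Opens (ℝ × EuclideanSpace ℝ (Fin 3))) : Set (ℝ × EuclideanSpace ℝ (Fin 3))))),
      uncurry (stPull 1 1 T x₀ u) z = uncurry ut z := by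
    refine ae_restrict_of_forall_mem hSm fun z hz => ?_
    rw [SetLike.mem_coe, mem_slab, mem_Iio] at hz
    change stPull 1 1 T x₀ u z.1 z.2 = ut z.1 z.2
    rw [hu' z.1 hz]
  have hpae : ∀ᵐ z ∂(volume.restrict (((slab (EuclideanSpace ℝ (Fin 3)) (Iio 0) isOpen_Iio :
      Opens (ℝ × EuclideanSpace ℝ (Fin 3))) : Set (ℝ × EuclideanSpace ℝ (Fin 3))))),
      uncurry (stPull 1 1 T x₀ p) z = uncurry pt z := by
    refine ae_restrict_of_forall_mem hSm fun z hz => ?_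
    rw [SetLike.mem_coe, mem_slab, mem_Iio] at hz
    change stPull 1 1 T x₀ p z.1 z.2 = pt z.1 z.2
    rw [hp' z.1 hz]
  have hswt : IsSuitableWeakSolutionOn (slab (EuclideanSpace ℝ (Fin 3)) (Iio 0) isOpen_Iio) 0 0 ut pt :=
    hsw'.congr_ae huae hpae
  have hHt' : HasWeakSpatialGradientOn (slab (EuclideanSpace ℝ (Fin 3)) (Iio 0) isOpen_Iio) ut (stPull 1 1 T x₀ H) :=
    hH'.congr_ae huae
  -- ### (1) finite origin gauges at the radius `R₀ = ‖x₀‖ + 2 − T`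
  have hR₀ : 0 < ‖x₀‖ + 2 - T := bigRadius_pos hT x₀
  have hgR := hgauge _ hR₀
  have hA₀ : cknA (‖x₀‖ + 2 - T) (0 : ℝ × EuclideanSpace ℝ (Fin 3)) u ≠ ⊤ :=
    ne_top_of_ofReal_mul_le (Real.rpow_pos_of_pos hR₀ _) (le_self_add.trans (le_self_add.trans hgR))
  have hE₀ : cknE (‖x₀‖ + 2 - T) (0 : ℝ × EuclideanSpace ℝ (Fin 3)) H ≠ ⊤ :=
    ne_top_of_ofReal_mul_le (Real.rpow_pos_of_pos hR₀ _) (le_add_self.trans (le_self_add.trans hgR))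
  have hD₀ : cknD (‖x₀‖ + 2 - T) (0 : ℝ × EuclideanSpace ℝ (Fin 3)) p ≠ ⊤ :=
    ne_top_of_ofReal_mul_le (Real.rpow_pos_of_pos hR₀ _) (le_add_self.trans hgR)
  -- ### (2) the `A`-gauge
  have hKA : ENNReal.ofReal (‖x₀‖ + 2 - T) * cknA (‖x₀‖ + 2 - T) (0 : ℝ × EuclideanSpace ℝ (Fin 3)) u ≠ ⊤ :=
    ENNReal.mul_ne_top ENNReal.ofReal_ne_top hA₀
  have hslice : ∀ t ∈ Ioo (-1 : ℝ) 0, ∫⁻ x in ball (0 : EuclideanSpace ℝ (Fin 3)) 1, ‖ut t x‖ₑ ^ 2 ≤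
      ENNReal.ofReal (‖x₀‖ + 2 - T) * cknA (‖x₀‖ + 2 - T) (0 : ℝ × EuclideanSpace ℝ (Fin 3)) u := by
    intro t ht
    rw [← hu' t ht.2]
    exact lintegral_ball_velocity_translate_le hT x₀ u ht
  obtain ⟨N, hN⟩ := exists_normEnergy_bound hρ2 (by linarith) hW.continuous (v := ut) (fun _ _ => rfl) hKA hslice
  have hAg := gaugeA_of_profile hρ2 (u := ut) (fun _ _ => rfl) hN
  -- ### (3) the `E`-gauge: the self-similar gradient of `∇W`
  have hW1 : ContDiff ℝ 1 W := hW.of_le (by norm_num)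
  have hGc : Continuous (fderiv ℝ W) := hW.continuous_fderiv (by norm_num)
  set H'' : ℝ → EuclideanSpace ℝ (Fin 3) → EuclideanSpace ℝ (Fin 3) →L[ℝ] EuclideanSpace ℝ (Fin 3) :=
    fun τ x => (-τ) ^ (-1 : ℝ) • fderiv ℝ W ((-τ) ^ (-γ) • x) with hH''def
  have hH''pt : ∀ τ : ℝ, τ < 0 → H'' τ = fun x => (-τ) ^ (-1 : ℝ) • fderiv ℝ W ((-τ) ^ (-(1 / (2 + ρ))) • x) :=
    fun _ _ => rfl
  -- identification of the translated weak gradient with `H''`, a.e. on the slab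
  obtain ⟨G', hG'm, hWG', hae⟩ := exists_profileGradient_ae hHt' (fun _ _ => rfl)
  have hGG : G' =ᵐ[volume] fderiv ℝ W := by
    have h1 := HasWeakFDerivOn.unique_holds hWG' (HasWeakFDerivOn.of_contDiff_holds ⊤ volume hW1)
    rwa [Opens.coe_top, Measure.restrict_univ] at h1
  have hae2 : ∀ᵐ τ ∂((volume : Measure ℝ).restrict (Iio (0 : ℝ))), stPull 1 1 T x₀ H τ =ᵐ[volume] H'' τ := by
    filter_upwards [hae, ae_restrict_mem measurableSet_Iio] with τ hτ hτ0
    have hs : 0 < -τ := neg_pos.2 hτ0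
    have hd : (-τ) ^ (-γ) ≠ 0 := (Real.rpow_pos_of_pos hs _).ne'
    have h3 : (fun x : EuclideanSpace ℝ (Fin 3) => G' ((-τ) ^ (-γ) • x)) =ᵐ[volume]
        fun x => fderiv ℝ W ((-τ) ^ (-γ) • x) :=
      (quasiMeasurePreserving_smul hd).ae_eq_comp hGG
    filter_upwards [hτ, h3] with x hx hx3
    rw [hx, hH''def]
    dsimp only
    rw [hx3]
  have hHm' : AEStronglyMeasurable (uncurry (stPull 1 1 T x₀ H))
      (((volume : Measure ℝ).restrict (Iio (0 : ℝ))).prod (volume : Measure (EuclideanSpace ℝ (Fin 3)))) := by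
    have := hHt'.locallyIntegrableOn_grad.aestronglyMeasurable
    rw [coe_slab, Measure.volume_eq_prod, ← Measure.prod_restrict, Measure.restrict_univ] at this
    exact this
  have hHm'' : AEStronglyMeasurable (uncurry H'')
      (((volume : Measure ℝ).restrict (Iio (0 : ℝ))).prod (volume : Measure (EuclideanSpace ℝ (Fin 3)))) := by
    have h1 := Past.aestronglyMeasurable_uncurry_selfSimilarGradient γ (T := 0) (T₁ := 0) le_rfl (0 : EuclideanSpace ℝ (Fin 3))
      hGc.aestronglyMeasurable
    have e : (uncurry fun (τ : ℝ) (x : EuclideanSpace ℝ (Fin 3)) =>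
        (0 - τ) ^ (-1 : ℝ) • fderiv ℝ W ((0 - τ) ^ (-γ) • (x - 0))) = uncurry H'' := by
      funext z
      simp only [uncurry, hH''def, zero_sub, sub_zero]
    rw [e] at h1
    exact h1
  have haeProd : uncurry (stPull 1 1 T x₀ H) =ᵐ[volume.restrict (Iio (0 : ℝ) ×ˢ (univ : Set (EuclideanSpace ℝ (Fin 3))))]
      uncurry H'' := by
    have := ae_eq_prod_of_ae_ae_eq hHm' hHm'' hae2
    rw [Measure.volume_eq_prod, ← Measure.prod_restrict, Measure.restrict_univ]
    exact this
  have hHt : HasWeakSpatialGradientOn (slab (EuclideanSpace ℝ (Fin 3)) (Iio 0) isOpen_Iio) ut H'' := by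
    refine hHt'.congr_grad_ae ?_
    rw [coe_slab]
    exact haeProd.mono fun z hz => hz.symm
  have hHm''slab : AEStronglyMeasurable (uncurry H'')
      (volume.restrict (Iio (0 : ℝ) ×ˢ (univ : Set (EuclideanSpace ℝ (Fin 3))))) := by
    rw [Measure.volume_eq_prod, ← Measure.prod_restrict, Measure.restrict_univ]; exact hHm''
  -- the unit-cylinder dissipation of `H''` is finite
  have hQ1sub : parabolicCylinder 1 (0 : ℝ × EuclideanSpace ℝ (Fin 3)) ⊆
      Iio (0 : ℝ) ×ˢ (univ : Set (EuclideanSpace ℝ (Fin 3))) := by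
    rintro ⟨t, x⟩ hz
    rw [mem_parabolicCylinder] at hz
    exact mem_prod.2 ⟨hz.1.2, mem_univ _⟩
  have hX_E : ∫⁻ q in parabolicCylinder 1 (0 : ℝ × EuclideanSpace ℝ (Fin 3)),
      ENNReal.ofReal (frobeniusNormSq (H'' q.1 q.2)) ≠ ⊤ := by
    have heq : ∫⁻ q in parabolicCylinder 1 (0 : ℝ × EuclideanSpace ℝ (Fin 3)), ENNReal.ofReal (frobeniusNormSq (H'' q.1 q.2)) =
        ∫⁻ q in parabolicCylinder 1 (0 : ℝ × EuclideanSpace ℝ (Fin 3)),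
          ENNReal.ofReal (frobeniusNormSq (stPull 1 1 T x₀ H q.1 q.2)) := by
      refine lintegral_congr_ae ?_
      filter_upwards [ae_restrict_of_ae_restrict_of_subset hQ1sub haeProd] with q hq
      rw [show H'' q.1 q.2 = uncurry H'' q from rfl, show stPull 1 1 T x₀ H q.1 q.2 = uncurry (stPull 1 1 T x₀ H) q from rfl, hq]
    rw [heq]
    exact ne_top_of_le_ne_top (ENNReal.mul_ne_top ENNReal.ofReal_ne_top hE₀)
      (lintegral_cylinder_gradient_translate_le hT x₀ H)
  have hME := gradientWeight_ne_top hρ2 hρ1 hGc hHm''slab hH''pt hX_E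
  have hEg := gaugeE_of_profile hρ2 hρ1 hGc.aestronglyMeasurable hHm''slab hH''pt
    (le_refl (∫⁻ z, ENNReal.ofReal (frobeniusNormSq (fderiv ℝ W z)) * ENNReal.ofReal (‖z‖ ^ (ρ - 1))))
  -- ### (4) the `D`-gauge: `Q ∈ L¹_loc`, the bridge to a `C¹` pressure, essential boundedness near `0`
  have hptm : AEStronglyMeasurable (uncurry pt)
      (volume.restrict (Iio (0 : ℝ) ×ˢ (univ : Set (EuclideanSpace ℝ (Fin 3))))) := by
    have := hswt.distributional.2.2.1.aestronglyMeasurable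
    rwa [coe_slab] at this
  have hQm : AEStronglyMeasurable Q volume := aestronglyMeasurable_pressureProfile hptm (fun _ _ => rfl)
  have hQloc : LocallyIntegrable Q volume :=
    Shifted.locallyIntegrable_pressureProfile_of_slab hγ0.le hγ1 hQm hswt.distributional.2.2.1
  obtain ⟨P', hprof⟩ := WeakToClassical.exists_isSelfSimilarEulerProfile_of_contDiff hswt.distributional
    (fun _ _ => rfl) (fun _ _ => rfl) hW hQloc
  obtain ⟨c₀, hQP⟩ := WeakToClassical.pressureProfile_ae_eq_add_const hswt.distributional
    (fun _ _ => rfl) (fun _ _ => rfl) hW hQloc hprof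
  obtain ⟨B, hB⟩ : ∃ B, ∀ z ∈ closedBall (0 : EuclideanSpace ℝ (Fin 3)) 1, ‖P' z‖ ≤ B :=
    (isCompact_closedBall 0 1).exists_bound_of_continuousOn hprof.contDiff_pressure.continuous.continuousOn
  have hQb : ∃ B' : ℝ, ∀ᵐ z ∂(volume.restrict (ball (0 : EuclideanSpace ℝ (Fin 3)) 1)), |Q z| ≤ B' := by
    refine ⟨B + |c₀|, ?_⟩
    filter_upwards [ae_restrict_of_ae hQP, ae_restrict_mem measurableSet_ball] with z hz hzb
    rw [hz]
    calc |P' z + c₀| ≤ |P' z| + |c₀| := abs_add_le _ _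
      _ ≤ B + |c₀| := by
          have := hB z (ball_subset_closedBall hzb)
          rw [Real.norm_eq_abs] at this
          linarith
  have hX_D : ∫⁻ q in parabolicCylinder 1 (0 : ℝ × EuclideanSpace ℝ (Fin 3)), ‖pt q.1 q.2‖ₑ ^ (3 / 2 : ℝ) ≠ ⊤ := by
    have heq : ∫⁻ q in parabolicCylinder 1 (0 : ℝ × EuclideanSpace ℝ (Fin 3)), ‖pt q.1 q.2‖ₑ ^ (3 / 2 : ℝ) =
        ∫⁻ q in parabolicCylinder 1 (0 : ℝ × EuclideanSpace ℝ (Fin 3)), ‖stPull 1 1 T x₀ p q.1 q.2‖ₑ ^ (3 / 2 : ℝ) := by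
      refine setLIntegral_congr_fun (isOpen_parabolicCylinder _ _).measurableSet fun q hq => ?_
      rw [mem_parabolicCylinder] at hq
      rw [hp' q.1 hq.1.2]
    rw [heq]
    exact ne_top_of_le_ne_top (ENNReal.mul_ne_top (ENNReal.pow_ne_top ENNReal.ofReal_ne_top) hD₀)
      (lintegral_cylinder_pressure_translate_le hT x₀ p)
  have hMD := pressureWeight_ne_top hρ hρ1 hQm hQb hptm (fun _ _ => rfl) hX_D
  have hDg := gaugeD_of_profile hρ2 hρ1 hQm hptm (fun _ _ => rfl)
    (le_refl (∫⁻ z, ‖Q z‖ₑ ^ (3 / 2 : ℝ) * ENNReal.ofReal (‖z‖ ^ (2 * ρ - 2))))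
  -- ### (5) assemble
  set cE : ℝ≥0∞ := ENNReal.ofReal ((2 + ρ) / (1 - ρ)) *
    ∫⁻ z, ENNReal.ofReal (frobeniusNormSq (fderiv ℝ W z)) * ENNReal.ofReal (‖z‖ ^ (ρ - 1)) with hcE
  set cD : ℝ≥0∞ := ENNReal.ofReal ((2 + ρ) / (2 - 2 * ρ)) *
    ∫⁻ z, ‖Q z‖ₑ ^ (3 / 2 : ℝ) * ENNReal.ofReal (‖z‖ ^ (2 * ρ - 2)) with hcD
  have hcE' : cE ≠ ⊤ := ENNReal.mul_ne_top ENNReal.ofReal_ne_top hME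
  have hcD' : cD ≠ ⊤ := ENNReal.mul_ne_top ENNReal.ofReal_ne_top hMD
  have htot : (N : ℝ≥0∞) + cE + cD ≠ ⊤ :=
    ENNReal.add_ne_top.2 ⟨ENNReal.add_ne_top.2 ⟨ENNReal.coe_ne_top, hcE'⟩, hcD'⟩
  refine ⟨H'', ((N : ℝ≥0∞) + cE + cD).toNNReal, hswt, hHt, fun a ha => ?_⟩
  rw [ENNReal.coe_toNNReal htot]
  exact add_le_add (add_le_add (hAg a ha) (hEg a ha)) (hDg a ha)

/-- **TRIVIALITY OF THE ANSATZ MEMBER KILLS THE CLOCK MEMBER** (crux hypotheses verbatim, `ρ₀ ≥ 0`; any rate `γ`, `W` continuous): if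
`selfSimilarCollapse γ 0 W = 0` a.e. on the slab then `W = 0`, the clock vanishes for `τ < T`, and the member vanishes on the WHOLE slab. [folklore] -/
theorem ae_eq_zero_of_selfSimilarCollapse_ae_eq_zero {γ : ℝ} (hρ₀ : 0 ≤ ρ₀)
    (hsw : IsSuitableWeakSolutionOn (slab (EuclideanSpace ℝ (Fin 3)) (Iio 0) isOpen_Iio) 0 0 u p)
    (hH : HasWeakSpatialGradientOn (slab (EuclideanSpace ℝ (Fin 3)) (Iio 0) isOpen_Iio) u H)
    (hgauge : ∀ a : ℝ, 0 < a →
      ENNReal.ofReal (a ^ (2 * ρ₀)) * cknA a (0 : ℝ × EuclideanSpace ℝ (Fin 3)) u +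
          ENNReal.ofReal (a ^ ρ₀) * cknE a (0 : ℝ × EuclideanSpace ℝ (Fin 3)) H +
        ENNReal.ofReal (a ^ (2 * ρ₀)) * cknD a (0 : ℝ × EuclideanSpace ℝ (Fin 3)) p ≤ (c : ℝ≥0∞))
    (hWc : Continuous W)
    (hu : ∀ τ : ℝ, τ < T → u τ = fun x => selfSimilarCollapse γ T W τ (x - x₀))
    (h0 : uncurry (selfSimilarCollapse γ 0 W) =ᵐ[volume.restrict (Iio (0 : ℝ) ×ˢ (univ : Set (EuclideanSpace ℝ (Fin 3))))] 0) :
    uncurry u =ᵐ[volume.restrict (Iio (0 : ℝ) ×ˢ (univ : Set (EuclideanSpace ℝ (Fin 3))))] 0 :=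
  Past.ae_eq_zero_of_profile_eq_zero (T₁ := T) hρ₀ hsw hH hgauge hu
    (profile_eq_zero_of_ae_eq_zero (v := selfSimilarCollapse γ 0 W) hWc (fun _ _ => rfl) h0)

/-- **BY-NAME INTERFACE FOR THE SKELETON: «the window is the origin-centred analysis at ρ′».**  Crux hypotheses verbatim at exponent `ρ₀ ≥ 0`;
the velocity/pressure an exact power clock of rate `1/(2+ρ)` about `(T, x₀)` for ALL `τ < T`, `T ≤ 0`, `−1/2 < ρ < 1`, `W ∈ C²`.  IF every class-`ρ`
member `(u′, p′, H′, c′)` that is exactly self-similar about the ORIGIN with profile `(W, Q)` at the class rate of `ρ` vanishes a.e. on the slab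
(`hkill` — inside `PowerGaugeEulerLiouville_of` this is the self-similar branch at exponent `ρ`, stubs being quantified over all exponents), THEN the
member vanishes a.e. on the slab. [folklore] -/
theorem ae_eq_zero_of_originAnalysis (hρ₀ : 0 ≤ ρ₀) (hρ : -1 / 2 < ρ) (hρ1 : ρ < 1)
    (hsw : IsSuitableWeakSolutionOn (slab (EuclideanSpace ℝ (Fin 3)) (Iio 0) isOpen_Iio) 0 0 u p)
    (hH : HasWeakSpatialGradientOn (slab (EuclideanSpace ℝ (Fin 3)) (Iio 0) isOpen_Iio) u H)
    (hgauge : ∀ a : ℝ, 0 < a →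
      ENNReal.ofReal (a ^ (2 * ρ₀)) * cknA a (0 : ℝ × EuclideanSpace ℝ (Fin 3)) u +
          ENNReal.ofReal (a ^ ρ₀) * cknE a (0 : ℝ × EuclideanSpace ℝ (Fin 3)) H +
        ENNReal.ofReal (a ^ (2 * ρ₀)) * cknD a (0 : ℝ × EuclideanSpace ℝ (Fin 3)) p ≤ (c : ℝ≥0∞))
    (hT : T ≤ 0) (x₀ : EuclideanSpace ℝ (Fin 3))
    (hu : ∀ τ : ℝ, τ < T → u τ = fun x => selfSimilarCollapse (1 / (2 + ρ)) T W τ (x - x₀))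
    (hp : ∀ τ : ℝ, τ < T → p τ = fun x => selfSimilarCollapsePressure (1 / (2 + ρ)) T Q τ (x - x₀))
    (hW : ContDiff ℝ 2 W)
    (hkill : ∀ (u' : ℝ → EuclideanSpace ℝ (Fin 3) → EuclideanSpace ℝ (Fin 3)) (p' : ℝ → EuclideanSpace ℝ (Fin 3) → ℝ)
        (H' : ℝ → EuclideanSpace ℝ (Fin 3) → EuclideanSpace ℝ (Fin 3) →L[ℝ] EuclideanSpace ℝ (Fin 3)) (c' : ℝ≥0),
      (IsSuitableWeakSolutionOn (slab (EuclideanSpace ℝ (Fin 3)) (Iio 0) isOpen_Iio) 0 0 u' p' ∧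
        HasWeakSpatialGradientOn (slab (EuclideanSpace ℝ (Fin 3)) (Iio 0) isOpen_Iio) u' H' ∧
        ∀ a : ℝ, 0 < a →
          ENNReal.ofReal (a ^ (2 * ρ)) * cknA a (0 : ℝ × EuclideanSpace ℝ (Fin 3)) u' +
              ENNReal.ofReal (a ^ ρ) * cknE a (0 : ℝ × EuclideanSpace ℝ (Fin 3)) H' +
            ENNReal.ofReal (a ^ (2 * ρ)) * cknD a (0 : ℝ × EuclideanSpace ℝ (Fin 3)) p' ≤ (c' : ℝ≥0∞)) →
      ((∀ τ : ℝ, τ < 0 → u' τ = selfSimilarCollapse (1 / (2 + ρ)) 0 W τ) ∧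
        (∀ τ : ℝ, τ < 0 → p' τ = selfSimilarCollapsePressure (1 / (2 + ρ)) 0 Q τ)) →
      uncurry u' =ᵐ[volume.restrict (Iio (0 : ℝ) ×ˢ (univ : Set (EuclideanSpace ℝ (Fin 3))))] 0) :
    uncurry u =ᵐ[volume.restrict (Iio (0 : ℝ) ×ˢ (univ : Set (EuclideanSpace ℝ (Fin 3))))] 0 := by
  obtain ⟨H'', c', hsw', hH', hg'⟩ := exists_inClass_selfSimilarCollapse hρ hρ1 hsw hH hgauge hT x₀ hu hp hW
  exact ae_eq_zero_of_selfSimilarCollapse_ae_eq_zero hρ₀ hsw hH hgauge hW.continuous hu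
    (hkill _ _ H'' c' ⟨hsw', hH', hg'⟩ ⟨fun _ _ => rfl, fun _ _ => rfl⟩)

end ClockTransfer

end Summit.NavierStokesRegularity.NavierStokesRegularity.Theorems.PowerGaugeEulerLiouville
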